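import Summits.QuantumFields.YangMills.Theorems.BalabanLadderIRTwistedSlabNoFlat
import Literature.Barriers.QuantumFields.DiscreteSubgroupFreezing
import HarnessLib

/-!
# The orthogonally twisted slab is exponentially suppressed in the classical limit: `W{z, zE}(β)/W{z, 1}(β) → 0` at fixed box

HELPER toward stub **T1** `TwistedSlabAnchor` (LINE `twisted-slab-continuity`, crux `IRcof` stmt-QuantumFields-26930, census row 43; LEAD prover
ym-ir-line-tsc-p1; `--supports` the crux, `--as helper`).  Third file of the programme «the e₂-projection in T1 is LOAD-BEARING» (memo
`Cruxes/IRcof/T1-ANATOMY-tsc-p1.md`): the β → ∞ (zeroth-order Laplace) consequence of `…NoFlat`.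

WHAT IS PROVED (one `Fin` box `(m₀+1) × (m₁+1) × (m₂+1) × (m₃+1)`, `β ≥ 0`, compact `G`, continuous unitary FAITHFUL `ρ`):
* §1 the tensor-twisted Wilson action `S_w(U) = Σ_x Σ_{μ<ν} (N − Re tr ρ(w_x · U_p(x)))` (written inline — no definition): `≥ 0` termwise (the tree's `sub_re_trace_map_nonneg` ∕ `re_trace_le_of_mem_unitaryGroup`),
  continuous, and `S_w(U) = 0 ⇒ U` is twisted-flat (`re_trace_le ∕ eq_one_of_re_trace_eq` of the tree + injectivity of `ρ`);
* §2 soft Laplace bounds: `S_w ≥ m` everywhere ⇒ `W{w}(β) ≤ e^{−βm}`; `S_w(U₀) = 0` for some `U₀` ⇒ `W{w}(β) ≥ v_ε·e^{−βε}` with `v_ε > 0` (the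
  product Haar measure charges the open set `{S_w < ε}`); no flat configuration ⇒ `min S_w > 0` (compactness);
* §3 the ladder configuration `U(x, μ) = Γ_μ` on the links with `x_μ = 0` (twist eaters `Γ₀Γ₁Γ₀⁻¹Γ₁⁻¹ = zM⁻¹`, `Γ₂ = Γ₃ = 1`) has
  `S_{slabTwist zM 1} = 0` — the magnetically twisted slab HAS a classical vacuum;
* §4 ★ `twistRatio_le_exp` ∕ `tendsto_twistRatio_zero` — if the `(zM, zE)` slab has no flat configuration and the `(zM, 1)` slab has one, then
  `W{zM, zE}(β) ≤ K·e^{−βδ}·W{zM, 1}(β)` for all `β ≥ 0` with `δ > 0`, hence `W{zM,zE}(β)/W{zM,1}(β) → 0` (`β → ∞`);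
  ★ `tendsto_twistRatio_zero_specialUnitary` — `SU(N)`, `zM = ω^k·1` (`k` a unit), every central `zE ≠ 1`, every faithful continuous unitary `ρ`.
READING: at fixed box the `e₂`-flux sectors of the magnetically twisted slab become DEGENERATE as `β → ∞` ('t Hooft: electric flux is
free in perturbation theory; the splitting is the fractional-instanton tunnelling rate `S_cl > 0`), so WITHOUT the e₂-projection the twisted
slab carries `N` vacua — the next file turns this into «uniform vacuum dominance fails for the unprojected slab».

HONEST FRAMING: one-box classical-limit bookkeeping (fixed lattice, `β → ∞`); nothing here is uniform in the box, nothing bears on `IRcof`,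
`IR`, or the Yang–Mills mass gap (Clay: NOT proved); R4 = `BalabanLadder.UV` only.  References: 't Hooft NPB 153 (1979) §§3–5;
González-Arroyo hep-th/9807108 §8; García Pérez–González-Arroyo–Okawa (2014) §2; Dembo–Zeitouni Thm 4.3.1 (Laplace principle).
-/

set_option autoImplicit false

noncomputable section

open MeasureTheory Filter Topology
open scoped BigOperators
open Literature.MathematicalPhysics.QuantumFieldTheory Literature.Barriers.QuantumFields
open Fin.NatCast

namespace Summit.QuantumFields.YangMills.Cruxes.IRcof.TwistedSlab

/-! ## §1 The tensor-twisted action: non-negative, continuous, zero only on twisted-flat configurations -/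

section Action

variable {G : Type*} [Group G] [TopologicalSpace G] [IsTopologicalGroup G] {N : ℕ} {ρ : G →* Matrix (Fin N) (Fin N) ℂ}
  {n₀ n₁ n₂ n₃ : ℕ}

omit [TopologicalSpace G] [IsTopologicalGroup G] in
/-- The tensor-twisted Wilson action of a box is non-negative (unitary `ρ`). [folklore] -/
theorem twistedAction_nonneg (hρu : ∀ g, ρ g ∈ Matrix.unitaryGroup (Fin N) ℂ) (w : Fin 4 → Fin 4 → G)
    (U : FinTorusSite n₀ n₁ n₂ n₃ × Fin 4 → G) :
    0 ≤ ∑ x : FinTorusSite n₀ n₁ n₂ n₃, ∑ q : {q : Fin 4 × Fin 4 // q.1 < q.2},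
      ((N : ℝ) - (ρ (tHooftTwistTensor w x q.1.1 q.1.2 * finTorusPlaquette U x q.1.1 q.1.2)).trace.re) :=
  Finset.sum_nonneg fun _ _ => Finset.sum_nonneg fun _ _ => sub_nonneg.2 (re_trace_le_of_mem_unitaryGroup (hρu _))

/-- The tensor-twisted Wilson action is continuous in the links (continuous `ρ`). [folklore] -/
theorem continuous_twistedAction (hρ : Continuous ρ) (w : Fin 4 → Fin 4 → G) :
    Continuous fun U : FinTorusSite n₀ n₁ n₂ n₃ × Fin 4 → G =>
      ∑ x : FinTorusSite n₀ n₁ n₂ n₃, ∑ q : {q : Fin 4 × Fin 4 // q.1 < q.2},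
        ((N : ℝ) - (ρ (tHooftTwistTensor w x q.1.1 q.1.2 * finTorusPlaquette U x q.1.1 q.1.2)).trace.re) := by
  have hU : ∀ l : FinTorusSite n₀ n₁ n₂ n₃ × Fin 4,
      Continuous fun U : FinTorusSite n₀ n₁ n₂ n₃ × Fin 4 → G => U l := fun l => continuous_apply l
  have hpl : ∀ (x : FinTorusSite n₀ n₁ n₂ n₃) (μ ν : Fin 4),
      Continuous fun U : FinTorusSite n₀ n₁ n₂ n₃ × Fin 4 → G => finTorusPlaquette U x μ ν := fun x μ ν =>
    (((hU _).mul (hU _)).mul (hU _).inv).mul (hU _).inv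
  have htr : Continuous fun g : G => (ρ g).trace.re := Complex.continuous_re.comp (Continuous.matrix_trace hρ)
  exact continuous_finsetSum _ fun x _ => continuous_finsetSum _ fun q _ =>
    continuous_const.sub (htr.comp (continuous_const.mul (hpl x _ _)))

omit [TopologicalSpace G] [IsTopologicalGroup G] in
/-- **Zero action forces twisted-flatness** (unitary FAITHFUL `ρ`): every term vanishes, `Re tr ρ(g) = N` forces `ρ(g) = 1`
(`eq_one_of_re_trace_eq`), hence `g = 1`. [folklore] -/
theorem twistedFlat_of_twistedAction_eq_zero (hρu : ∀ g, ρ g ∈ Matrix.unitaryGroup (Fin N) ℂ) (hinj : Function.Injective ρ)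
    (w : Fin 4 → Fin 4 → G) (U : FinTorusSite n₀ n₁ n₂ n₃ × Fin 4 → G)
    (h0 : ∑ x : FinTorusSite n₀ n₁ n₂ n₃, ∑ q : {q : Fin 4 × Fin 4 // q.1 < q.2},
      ((N : ℝ) - (ρ (tHooftTwistTensor w x q.1.1 q.1.2 * finTorusPlaquette U x q.1.1 q.1.2)).trace.re) = 0) :
    ∀ (x : FinTorusSite n₀ n₁ n₂ n₃) (μ ν : Fin 4), μ < ν →
      tHooftTwistTensor w x μ ν * finTorusPlaquette U x μ ν = 1 := by
  intro x μ ν hμν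
  have hx := (Finset.sum_eq_zero_iff_of_nonneg (fun x _ => Finset.sum_nonneg fun q _ => sub_nonneg.2 (re_trace_le_of_mem_unitaryGroup (hρu _)))).1 h0 x
    (Finset.mem_univ x)
  have hq := (Finset.sum_eq_zero_iff_of_nonneg (fun q _ => sub_nonneg.2 (re_trace_le_of_mem_unitaryGroup (hρu _)))).1 hx ⟨(μ, ν), hμν⟩ (Finset.mem_univ _)
  have htr : (ρ (tHooftTwistTensor w x μ ν * finTorusPlaquette U x μ ν)).trace.re = N := by
    simp only at hq; linarith
  have h1 : ρ (tHooftTwistTensor w x μ ν * finTorusPlaquette U x μ ν) = 1 := eq_one_of_re_trace_eq (hρu _) htr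
  exact hinj (by rw [h1, map_one])

end Action

/-! ## §2 Soft Laplace bounds on one box -/

section Laplace

variable {G : Type*} [Group G] [TopologicalSpace G] [IsTopologicalGroup G] [CompactSpace G]
  [MeasurableSpace G] [BorelSpace G] [SecondCountableTopology G] {N : ℕ} {ρ : G →* Matrix (Fin N) (Fin N) ℂ}
  {n₀ n₁ n₂ n₃ : ℕ}

omit [SecondCountableTopology G] in
/-- **Upper Laplace bound**: if the twisted action is `≥ m` everywhere then `W{w}(β) ≤ e^{−βm}` for `β ≥ 0` (probability measure).
[folklore] -/
theorem twistedPartition_le_exp_of_le_action {β : ℝ} (hβ : 0 ≤ β) (w : Fin 4 → Fin 4 → G) {m : ℝ}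
    (hm : ∀ U : FinTorusSite n₀ n₁ n₂ n₃ × Fin 4 → G,
      m ≤ ∑ x : FinTorusSite n₀ n₁ n₂ n₃, ∑ q : {q : Fin 4 × Fin 4 // q.1 < q.2},
        ((N : ℝ) - (ρ (tHooftTwistTensor w x q.1.1 q.1.2 * finTorusPlaquette U x q.1.1 q.1.2)).trace.re)) :
    wilsonFinTorusTensorTwistedPartition ρ β w n₀ n₁ n₂ n₃ ≤ Real.exp (-(β * m)) := by
  haveI : IsProbabilityMeasure (Measure.pi fun _ : FinTorusSite n₀ n₁ n₂ n₃ × Fin 4 => haarProbability G) := by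
    infer_instance
  rw [wilsonFinTorusTensorTwistedPartition_def]
  unfold wilsonFinTorusPlaqTwistedPartition
  calc _ ≤ ∫ _U : FinTorusSite n₀ n₁ n₂ n₃ × Fin 4 → G, Real.exp (-(β * m))
          ∂(Measure.pi fun _ : FinTorusSite n₀ n₁ n₂ n₃ × Fin 4 => haarProbability G) := by
        refine integral_mono_of_nonneg (Eventually.of_forall fun U => (Real.exp_pos _).le) (integrable_const _)
          (Eventually.of_forall fun U => Real.exp_le_exp.2 ?_)
        have := hm U
        nlinarith
    _ = Real.exp (-(β * m)) := by simp

/-- **Lower Laplace bound**: if the twisted action vanishes somewhere then for every `ε > 0` there is `v > 0` (the product Haar mass of the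
open set `{S_w < ε}`) with `v·e^{−βε} ≤ W{w}(β)` for all `β ≥ 0`. [folklore] -/
theorem exists_mul_exp_le_twistedPartition (hρ : Continuous ρ) (w : Fin 4 → Fin 4 → G)
    (h0 : ∃ U₀ : FinTorusSite n₀ n₁ n₂ n₃ × Fin 4 → G,
      ∑ x : FinTorusSite n₀ n₁ n₂ n₃, ∑ q : {q : Fin 4 × Fin 4 // q.1 < q.2},
        ((N : ℝ) - (ρ (tHooftTwistTensor w x q.1.1 q.1.2 * finTorusPlaquette U₀ x q.1.1 q.1.2)).trace.re) = 0)
    {ε : ℝ} (hε : 0 < ε) :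
    ∃ v : ℝ, 0 < v ∧ ∀ β : ℝ, 0 ≤ β →
      v * Real.exp (-(β * ε)) ≤ wilsonFinTorusTensorTwistedPartition ρ β w n₀ n₁ n₂ n₃ := by
  haveI : (haarProbability G).IsOpenPosMeasure := by unfold haarProbability; infer_instance
  haveI : IsProbabilityMeasure (Measure.pi fun _ : FinTorusSite n₀ n₁ n₂ n₃ × Fin 4 => haarProbability G) := by
    infer_instance
  set μH : Measure (FinTorusSite n₀ n₁ n₂ n₃ × Fin 4 → G) :=
    Measure.pi fun _ : FinTorusSite n₀ n₁ n₂ n₃ × Fin 4 => haarProbability G with hμH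
  set S : (FinTorusSite n₀ n₁ n₂ n₃ × Fin 4 → G) → ℝ := fun U =>
    ∑ x : FinTorusSite n₀ n₁ n₂ n₃, ∑ q : {q : Fin 4 × Fin 4 // q.1 < q.2},
      ((N : ℝ) - (ρ (tHooftTwistTensor w x q.1.1 q.1.2 * finTorusPlaquette U x q.1.1 q.1.2)).trace.re) with hS
  have hSc : Continuous S := continuous_twistedAction hρ w
  obtain ⟨U₀, hU₀⟩ := h0
  -- the open set `{S < ε}` is non-empty, hence has positive product Haar mass
  have hopen : IsOpen {U | S U < ε} := isOpen_lt hSc continuous_const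
  have hne : ({U | S U < ε} : Set _).Nonempty := ⟨U₀, by show S U₀ < ε; rw [show S U₀ = 0 from hU₀]; exact hε⟩
  have hpos : 0 < μH {U | S U < ε} := hopen.measure_pos μH hne
  have hfin : μH {U | S U < ε} ≠ ⊤ := measure_ne_top _ _
  refine ⟨(μH {U | S U < ε}).toReal, ENNReal.toReal_pos hpos.ne' hfin, fun β hβ => ?_⟩
  rw [wilsonFinTorusTensorTwistedPartition_def]
  unfold wilsonFinTorusPlaqTwistedPartition
  have hmeas : MeasurableSet {U | S U < ε} := hopen.measurableSet
  -- `v e^{−βε} = ∫ 1_{S<ε} e^{−βε} ≤ ∫ e^{−βS}`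
  have hind : ∀ U, ({U | S U < ε} : Set _).indicator (fun _ => Real.exp (-(β * ε))) U ≤ Real.exp (-β * S U) := by
    intro U
    by_cases hU : U ∈ ({U | S U < ε} : Set _)
    · rw [Set.indicator_of_mem hU]
      have hU' : S U < ε := hU
      exact Real.exp_le_exp.2 (by nlinarith)
    · rw [Set.indicator_of_notMem hU]
      exact (Real.exp_pos _).le
  have hint : Integrable (fun U => Real.exp (-β * S U)) μH :=
    (continuous_finTorusPlaqTwistedWeight ρ hρ β (tHooftTwistTensor w)).integrable_of_hasCompactSupport
      (IsCompact.of_isClosed_subset isCompact_univ (isClosed_tsupport _) (Set.subset_univ _))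
  calc (μH {U | S U < ε}).toReal * Real.exp (-(β * ε))
      = ∫ U, ({U | S U < ε} : Set _).indicator (fun _ => Real.exp (-(β * ε))) U ∂μH := by
        rw [integral_indicator_const _ hmeas, smul_eq_mul, measureReal_def]
    _ ≤ ∫ U, Real.exp (-β * S U) ∂μH := integral_mono ((integrable_const _).indicator hmeas) hint hind

omit [MeasurableSpace G] [BorelSpace G] [SecondCountableTopology G] in
/-- **No flat configuration ⇒ a positive action floor** (compactness: the continuous action attains its infimum, which is not `0`).
[folklore] -/
theorem exists_pos_le_twistedAction_of_noFlat (hρ : Continuous ρ) (hρu : ∀ g, ρ g ∈ Matrix.unitaryGroup (Fin N) ℂ)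
    (hinj : Function.Injective ρ) (w : Fin 4 → Fin 4 → G)
    (hno : ∀ U : FinTorusSite n₀ n₁ n₂ n₃ × Fin 4 → G, ¬ ∀ (x : FinTorusSite n₀ n₁ n₂ n₃) (μ ν : Fin 4), μ < ν →
      tHooftTwistTensor w x μ ν * finTorusPlaquette U x μ ν = 1) :
    ∃ m : ℝ, 0 < m ∧ ∀ U : FinTorusSite n₀ n₁ n₂ n₃ × Fin 4 → G,
      m ≤ ∑ x : FinTorusSite n₀ n₁ n₂ n₃, ∑ q : {q : Fin 4 × Fin 4 // q.1 < q.2},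
        ((N : ℝ) - (ρ (tHooftTwistTensor w x q.1.1 q.1.2 * finTorusPlaquette U x q.1.1 q.1.2)).trace.re) := by
  set S : (FinTorusSite n₀ n₁ n₂ n₃ × Fin 4 → G) → ℝ := fun U =>
    ∑ x : FinTorusSite n₀ n₁ n₂ n₃, ∑ q : {q : Fin 4 × Fin 4 // q.1 < q.2},
      ((N : ℝ) - (ρ (tHooftTwistTensor w x q.1.1 q.1.2 * finTorusPlaquette U x q.1.1 q.1.2)).trace.re) with hS
  have hSc : Continuous S := continuous_twistedAction hρ w
  haveI : Nonempty (FinTorusSite n₀ n₁ n₂ n₃ × Fin 4 → G) := ⟨fun _ => 1⟩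
  obtain ⟨U₀, -, hU₀⟩ := isCompact_univ.exists_isMinOn Set.univ_nonempty hSc.continuousOn
  rw [isMinOn_univ_iff] at hU₀
  refine ⟨S U₀, lt_of_le_of_ne (twistedAction_nonneg hρu w U₀) (fun h => hno U₀ ?_), hU₀⟩
  exact twistedFlat_of_twistedAction_eq_zero hρu hinj w U₀ h.symm

end Laplace

/-! ## §3 The magnetically twisted slab has a classical vacuum: the ladder configuration of a twist-eating pair -/

section Eater

variable {G : Type*} [Group G] {m₀ m₁ m₂ m₃ : ℕ}

/-- Shifting in direction `μ` does not change the other coordinates of a `Fin` site. [folklore] -/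
private theorem coord_shift_of_ne (x : FinTorusSite (m₀ + 1) (m₁ + 1) (m₂ + 1) (m₃ + 1)) {μ ν : Fin 4} (h : ν ≠ μ) :
    finTorusSiteCoord (x.shift μ) ν = finTorusSiteCoord x ν := by
  obtain ⟨a, b, c, d⟩ := x
  fin_cases μ <;> fin_cases ν <;> first | exact absurd rfl h | rfl

/-- **The ladder configuration eats the magnetic twist.**  For `Γ₀ Γ₁ Γ₀⁻¹ Γ₁⁻¹ = zM⁻¹` put `Γ₀` on the links in direction `0` with
`x₀ = 0`, `Γ₁` on the links in direction `1` with `x₁ = 0`, and `1` elsewhere: every plaquette holonomy times its slab twist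
`slabTwist zM 1` (magnetic `zM` on the stack `x₀ = x₁ = 0`, no electric twist) is trivial. [folklore] -/
theorem ladder_twistedFlat {zM Γ₀ Γ₁ : G} (hΓ : Γ₀ * Γ₁ * Γ₀⁻¹ * Γ₁⁻¹ = zM⁻¹)
    (x : FinTorusSite (m₀ + 1) (m₁ + 1) (m₂ + 1) (m₃ + 1)) {μ ν : Fin 4} (hμν : μ < ν) :
    tHooftTwistTensor (slabTwist zM 1) x μ ν *
      finTorusPlaquette (fun l : FinTorusSite (m₀ + 1) (m₁ + 1) (m₂ + 1) (m₃ + 1) × Fin 4 =>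
        if l.2 = 0 ∧ finTorusSiteCoord l.1 0 = 0 then Γ₀
        else if l.2 = 1 ∧ finTorusSiteCoord l.1 1 = 0 then Γ₁ else 1) x μ ν = 1 := by
  have hzM : zM * (Γ₀ * (Γ₁ * (Γ₀⁻¹ * Γ₁⁻¹))) = 1 := by
    rw [show Γ₀ * (Γ₁ * (Γ₀⁻¹ * Γ₁⁻¹)) = Γ₀ * Γ₁ * Γ₀⁻¹ * Γ₁⁻¹ by group, hΓ, mul_inv_cancel]
  unfold tHooftTwistTensor finTorusPlaquette slabTwist
  -- the coordinates of the shifted sites that are read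
  have h10 : finTorusSiteCoord (x.shift 0) 1 = finTorusSiteCoord x 1 := coord_shift_of_ne x (by decide)
  have h01 : finTorusSiteCoord (x.shift 1) 0 = finTorusSiteCoord x 0 := coord_shift_of_ne x (by decide)
  have h20 : finTorusSiteCoord (x.shift 2) 0 = finTorusSiteCoord x 0 := coord_shift_of_ne x (by decide)
  have h21 : finTorusSiteCoord (x.shift 2) 1 = finTorusSiteCoord x 1 := coord_shift_of_ne x (by decide)
  have h30 : finTorusSiteCoord (x.shift 3) 0 = finTorusSiteCoord x 0 := coord_shift_of_ne x (by decide)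
  have h31 : finTorusSiteCoord (x.shift 3) 1 = finTorusSiteCoord x 1 := coord_shift_of_ne x (by decide)
  fin_cases μ <;> fin_cases ν <;> simp_all only [Fin.lt_def] <;> norm_num at hμν <;>
    (by_cases hx0 : finTorusSiteCoord x 0 = 0 <;> by_cases hx1 : finTorusSiteCoord x 1 = 0 <;>
      simp [hx0, hx1, h10, h01, h20, h21, h30, h31, hzM, mul_assoc])

end Eater

/-! ## §4 The ratio `W{zM, zE}/W{zM, 1}` vanishes in the classical limit -/

section Ratio

variable {G : Type*} [Group G] [TopologicalSpace G] [IsTopologicalGroup G] [CompactSpace G]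
  [MeasurableSpace G] [BorelSpace G] [SecondCountableTopology G] {N : ℕ} {ρ : G →* Matrix (Fin N) (Fin N) ℂ}
  {n₀ n₁ n₂ n₃ : ℕ}

omit [TopologicalSpace G] [IsTopologicalGroup G] [CompactSpace G] [MeasurableSpace G] [BorelSpace G]
  [SecondCountableTopology G] in
/-- A twisted-flat configuration has zero twisted action (`tr ρ(1) = N`). [folklore] -/
theorem twistedAction_eq_zero_of_flat (w : Fin 4 → Fin 4 → G) (U : FinTorusSite n₀ n₁ n₂ n₃ × Fin 4 → G)
    (hU : ∀ (x : FinTorusSite n₀ n₁ n₂ n₃) (μ ν : Fin 4), μ < ν → tHooftTwistTensor w x μ ν * finTorusPlaquette U x μ ν = 1) :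
    ∑ x : FinTorusSite n₀ n₁ n₂ n₃, ∑ q : {q : Fin 4 × Fin 4 // q.1 < q.2},
      ((N : ℝ) - (ρ (tHooftTwistTensor w x q.1.1 q.1.2 * finTorusPlaquette U x q.1.1 q.1.2)).trace.re) = 0 := by
  refine Finset.sum_eq_zero fun x _ => Finset.sum_eq_zero fun q _ => ?_
  rw [hU x q.1.1 q.1.2 q.2, map_one, Matrix.trace_one, Fintype.card_fin]
  simp

/-- ★ **THE ORTHOGONALLY TWISTED SLAB IS EXPONENTIALLY SUPPRESSED** (one box, `β ≥ 0`, compact `G`, continuous unitary faithful `ρ`): if the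
`wE`-twisted box has NO twisted-flat configuration and the `w0`-twisted box HAS one, then for some `K, δ > 0`
`W{wE}(β) ≤ K·e^{−βδ}·W{w0}(β)` for all `β ≥ 0` (`δ` = half the minimal `wE`-action: zeroth-order Laplace on both sides).
[folklore] -/
theorem twistRatio_le_exp (hρ : Continuous ρ) (hρu : ∀ g, ρ g ∈ Matrix.unitaryGroup (Fin N) ℂ)
    (hinj : Function.Injective ρ) {wE w0 : Fin 4 → Fin 4 → G}
    (hnoE : ∀ U : FinTorusSite n₀ n₁ n₂ n₃ × Fin 4 → G, ¬ ∀ (x : FinTorusSite n₀ n₁ n₂ n₃) (μ ν : Fin 4), μ < ν →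
      tHooftTwistTensor wE x μ ν * finTorusPlaquette U x μ ν = 1)
    (h0 : ∃ U₀ : FinTorusSite n₀ n₁ n₂ n₃ × Fin 4 → G, ∀ (x : FinTorusSite n₀ n₁ n₂ n₃) (μ ν : Fin 4), μ < ν →
      tHooftTwistTensor w0 x μ ν * finTorusPlaquette U₀ x μ ν = 1) :
    ∃ K δ : ℝ, 0 < K ∧ 0 < δ ∧ ∀ β : ℝ, 0 ≤ β →
      wilsonFinTorusTensorTwistedPartition ρ β wE n₀ n₁ n₂ n₃ ≤
        K * Real.exp (-(β * δ)) * wilsonFinTorusTensorTwistedPartition ρ β w0 n₀ n₁ n₂ n₃ := by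
  obtain ⟨m, hm, hmle⟩ := exists_pos_le_twistedAction_of_noFlat hρ hρu hinj wE hnoE
  obtain ⟨U₀, hU₀⟩ := h0
  obtain ⟨v, hv, hvle⟩ := exists_mul_exp_le_twistedPartition (n₀ := n₀) (n₁ := n₁) (n₂ := n₂) (n₃ := n₃) hρ w0
    ⟨U₀, twistedAction_eq_zero_of_flat w0 U₀ hU₀⟩ (half_pos hm)
  refine ⟨v⁻¹, m / 2, inv_pos.2 hv, half_pos hm, fun β hβ => ?_⟩
  have hE := twistedPartition_le_exp_of_le_action (n₀ := n₀) (n₁ := n₁) (n₂ := n₂) (n₃ := n₃) (ρ := ρ) hβ wE hmle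
  have h0' := hvle β hβ
  -- `W_E ≤ e^{−βm} = e^{−βm/2} · e^{−βm/2} ≤ e^{−βm/2} · W_0 / v`
  have hsplit : Real.exp (-(β * m)) = Real.exp (-(β * (m / 2))) * Real.exp (-(β * (m / 2))) := by
    rw [← Real.exp_add]; ring_nf
  calc wilsonFinTorusTensorTwistedPartition ρ β wE n₀ n₁ n₂ n₃ ≤ Real.exp (-(β * m)) := hE
    _ = Real.exp (-(β * (m / 2))) * (v⁻¹ * (v * Real.exp (-(β * (m / 2))))) := by
        rw [hsplit, ← mul_assoc v⁻¹, inv_mul_cancel₀ hv.ne', one_mul]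
    _ ≤ Real.exp (-(β * (m / 2))) * (v⁻¹ * wilsonFinTorusTensorTwistedPartition ρ β w0 n₀ n₁ n₂ n₃) :=
        mul_le_mul_of_nonneg_left (mul_le_mul_of_nonneg_left h0' (inv_pos.2 hv).le) (Real.exp_pos _).le
    _ = v⁻¹ * Real.exp (-(β * (m / 2))) * wilsonFinTorusTensorTwistedPartition ρ β w0 n₀ n₁ n₂ n₃ := by ring

/-- ★ **Classical limit of the ratio**: under the hypotheses of `twistRatio_le_exp`, `W{wE}(β)/W{w0}(β) → 0` as `β → ∞`.
[folklore] -/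
theorem tendsto_twistRatio_zero (hρ : Continuous ρ) (hρu : ∀ g, ρ g ∈ Matrix.unitaryGroup (Fin N) ℂ)
    (hinj : Function.Injective ρ) {wE w0 : Fin 4 → Fin 4 → G}
    (hnoE : ∀ U : FinTorusSite n₀ n₁ n₂ n₃ × Fin 4 → G, ¬ ∀ (x : FinTorusSite n₀ n₁ n₂ n₃) (μ ν : Fin 4), μ < ν →
      tHooftTwistTensor wE x μ ν * finTorusPlaquette U x μ ν = 1)
    (h0 : ∃ U₀ : FinTorusSite n₀ n₁ n₂ n₃ × Fin 4 → G, ∀ (x : FinTorusSite n₀ n₁ n₂ n₃) (μ ν : Fin 4), μ < ν →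
      tHooftTwistTensor w0 x μ ν * finTorusPlaquette U₀ x μ ν = 1) :
    Tendsto (fun β : ℝ => wilsonFinTorusTensorTwistedPartition ρ β wE n₀ n₁ n₂ n₃ /
      wilsonFinTorusTensorTwistedPartition ρ β w0 n₀ n₁ n₂ n₃) atTop (𝓝 0) := by
  obtain ⟨K, δ, hK, hδ, hle⟩ := twistRatio_le_exp hρ hρu hinj hnoE h0
  have hW0 : ∀ β, 0 < wilsonFinTorusTensorTwistedPartition ρ β w0 n₀ n₁ n₂ n₃ := fun β =>
    wilsonFinTorusTensorTwistedPartition_pos ρ hρ β w0 n₀ n₁ n₂ n₃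
  have hup : Tendsto (fun β : ℝ => K * Real.exp (-(β * δ))) atTop (𝓝 0) := by
    have h1 : Tendsto (fun β : ℝ => -(β * δ)) atTop atBot :=
      tendsto_neg_atTop_atBot.comp (tendsto_id.atTop_mul_const hδ)
    simpa using tendsto_const_nhds.mul (Real.tendsto_exp_atBot.comp h1)
  refine tendsto_of_tendsto_of_tendsto_of_le_of_le' tendsto_const_nhds hup ?_ ?_
  · filter_upwards [eventually_ge_atTop (0 : ℝ)] with β hβ
    exact div_nonneg (wilsonFinTorusTensorTwistedPartition_pos ρ hρ β wE n₀ n₁ n₂ n₃).le (hW0 β).le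
  · filter_upwards [eventually_ge_atTop (0 : ℝ)] with β hβ
    rw [div_le_iff₀ (hW0 β)]
    exact hle β hβ

end Ratio

/-! ## §5 `SU(N)`: the slab with magnetic twist `ω^k·1` and any non-trivial central electric twist is exponentially suppressed -/

section SpecialUnitary

open Literature.MathematicalPhysics.QuantumLattice

variable {N : ℕ} [NeZero N] [MeasurableSpace (Matrix.specialUnitaryGroup (Fin N) ℂ)]
  [BorelSpace (Matrix.specialUnitaryGroup (Fin N) ℂ)] {d : ℕ}
  {ρ : Matrix.specialUnitaryGroup (Fin N) ℂ →* Matrix (Fin d) (Fin d) ℂ} {m₀ m₁ m₂ m₃ : ℕ}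

/-- ★ **`SU(N)` — THE ELECTRIC TWIST DECOUPLES IN THE CLASSICAL LIMIT OF THE MAGNETICALLY TWISTED SLAB.**  For `zM = ω^k·1` with `k` a unit
of `ℤ/N`, EVERY central `zE ≠ 1`, every faithful continuous unitary `ρ` and every box `(m₀+1)×(m₁+1)×(m₂+1)×(m₃+1)`:
`W{slabTwist zM zE}(β) / W{slabTwist zM 1}(β) → 0` as `β → ∞`.  (No flat configuration with the orthogonal twist — `…NoFlat` —, the
ladder of lit-4's twist-eating pair for the magnetic one; 't Hooft: the `e₂`-flux free energy vanishes in the classical ∕ perturbative limit,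
so the unprojected twisted slab has `N` degenerate vacua.)  HONEST: fixed box, `β → ∞`; nothing uniform. [cite: tHooft1979Flux, §5] -/
theorem tendsto_twistRatio_zero_specialUnitary {k : ZMod N} (hk : IsUnit k) {zE : Matrix.specialUnitaryGroup (Fin N) ℂ}
    (hEc : zE ∈ Subgroup.center (Matrix.specialUnitaryGroup (Fin N) ℂ)) (hE1 : zE ≠ 1)
    (hρ : Continuous ρ) (hρu : ∀ g, ρ g ∈ Matrix.unitaryGroup (Fin d) ℂ) (hinj : Function.Injective ρ) :
    Tendsto (fun β : ℝ =>
      wilsonFinTorusTensorTwistedPartition ρ β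
          (slabTwist (suCenter N k : Matrix.specialUnitaryGroup (Fin N) ℂ) zE) (m₀ + 1) (m₁ + 1) (m₂ + 1) (m₃ + 1) /
        wilsonFinTorusTensorTwistedPartition ρ β
          (slabTwist (suCenter N k : Matrix.specialUnitaryGroup (Fin N) ℂ) 1) (m₀ + 1) (m₁ + 1) (m₂ + 1) (m₃ + 1))
      atTop (𝓝 0) := by
  -- the magnetic twist is eaten by a pair with commutator `(ω^k·1)⁻¹ = ω^{−k}·1`
  obtain ⟨A, B, hAB⟩ := exists_pair_commutator_eq_suCenter (N := N) (-k)
  have hAB' : A * B * A⁻¹ * B⁻¹ = ((suCenter N k : Matrix.specialUnitaryGroup (Fin N) ℂ))⁻¹ := by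
    rw [hAB, Literature.MathematicalPhysics.QuantumFieldTheory.suCenter_neg]; rfl
  refine tendsto_twistRatio_zero hρ hρu hinj (no_twistedFlat_slab_specialUnitary hk hEc hE1)
    ⟨fun l => if l.2 = 0 ∧ finTorusSiteCoord l.1 0 = 0 then A
      else if l.2 = 1 ∧ finTorusSiteCoord l.1 1 = 0 then B else 1, fun x μ ν hμν => ladder_twistedFlat hAB' x hμν⟩

end SpecialUnitary

end Summit.QuantumFields.YangMills.Cruxes.IRcof.TwistedSlab

end
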